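import Literature.AlgebraicGeometry.Frobenioids.ArithmeticFrobenioidModel
import Literature.AlgebraicGeometry.Frobenioids.FinSubextCatDivSlim
import Literature.NumberTheory.NumberFields.AutomorphismMovesPrime
import HarnessLib

/-!
# Frobenioids I, Theorem 6.4 (i): `D` is Div-slim with respect to the arithmetic divisor monoid `Φ` — PROOF
# for the CONSTRUCTED model `C_{K/F}`

Mochizuki, *The geometry of Frobenioids I*, Kyushu J. Math. **62** (2008), Thm. 6.4 (i), kurims p. 114:
"`D` is Frobenius-slim and Div-slim [with respect to `Φ`, …]"; proof p. 115: "since any automorphism of a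
number field that fixes all of the valuations of the number field is clearly equal to the identity
automorphism, it follows immediately that … `D` is Div-slim". [cite: MochizukiFrdI2008, Thm. 6.4 (i) p.114]

PROVED here (seat abc-iut-L6-t10) for the operations `arithFrobenioidOps F K` of the constructed
arithmetic model Frobenioid (`ArithmeticFrobenioidModel.lean`), by the Div-slim criterion of
`FinSubextCatDivSlim.lean` (Thm. 6.2 (iv)): its two inputs hold for the genuine arithmetic divisor
monoid — `pullInjective_arith` (pull-back of effective arithmetic divisors along an embedding of number
fields is injective: every place has a place above it, ramification indices are nonzero) and
`movesSomeGalois_arith` (a nontrivial `z ∈ Z` restricts to a nontrivial automorphism of a finite Galois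
`L`, which moves a prime of `L` by `NumberFields.exists_map_heightOneSpectrum_ne`, hence moves the
corresponding prime divisor). Conclusion: `isDivSlim_arith` — every automorphism of `D_A → D` acting
trivially on all `Φ(L')` is trivial. The packaging as the conjunct of abc-iut-L1-t3's `Thm64i_base` is in the
companion of `ArithmeticFrobenioids.lean`.
-/

noncomputable section

namespace Literature.AlgebraicGeometry.Frobenioids

open CategoryTheory Opposite NumberField IsDedekindDomain IntermediateField

namespace ArithPullback

universe u

variable {M : Type u} [Field M] [NumberField M] {L : Type u} [Field L] [NumberField L]

/-- `e(w | σ⁻¹ w) ≠ 0`. [cite: MochizukiFrdI2008, Ex. 6.3 p.113] -/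
theorem ramIdx_ne_zero (σ : M →+* L) (w : HeightOneSpectrum (𝓞 L)) : ramIdx σ w ≠ 0 := by
  intro h0
  obtain ⟨π, hπv, hπ0⟩ := Submodule.exists_mem_ne_zero_of_ne_bot (under σ w).ne_bot
  have h1 := valuation_apply σ w (π : M)
  rw [h0, pow_zero] at h1
  have h2 : w.valuation L (σ (π : M)) < 1 := by
    rw [show σ (π : M) = algebraMap (𝓞 L) L (RingOfIntegers.mapRingHom σ π) from rfl,
      HeightOneSpectrum.valuation_of_algebraMap, HeightOneSpectrum.intValuation_lt_one_iff_mem]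
    exact hπv
  rw [h1] at h2
  exact lt_irrefl _ h2

omit [NumberField L] in
/-- Every prime of `M` lies below some prime of `L` (along any embedding `σ : M →+* L`).
[cite: MochizukiFrdI2008, Ex. 6.3 p.113] -/
theorem under_surjective (σ : M →+* L) : Function.Surjective (under σ) := by
  intro v
  letI : Algebra M L := σ.toAlgebra
  haveI : FaithfulSMul (𝓞 M) (𝓞 L) :=
    (faithfulSMul_iff_algebraMap_injective (𝓞 M) (𝓞 L)).mpr (RingOfIntegers.algebraMap.injective M L)
  haveI := v.isPrime.isMaximal v.ne_bot
  obtain ⟨Q, hQmax, hQ⟩ := Ideal.exists_maximal_ideal_liesOver_of_isIntegral (S := 𝓞 L) v.asIdeal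
  have hQ0 : Q ≠ ⊥ := Ideal.ne_bot_of_liesOver_of_ne_bot v.ne_bot Q
  refine ⟨⟨Q, hQmax.isPrime, hQ0⟩, HeightOneSpectrum.ext ?_⟩
  exact hQ.over.symm

/-- Every finite place of `M` lies below some finite place of `L`. [cite: MochizukiFrdI2008, Ex. 6.3 p.113] -/
theorem underPlace_surjective (σ : M →+* L) : Function.Surjective (underPlace σ) := by
  intro v
  obtain ⟨w, hw⟩ := under_surjective σ v.maximalIdeal
  refine ⟨FinitePlace.mk w, ?_⟩
  rw [underPlace, FinitePlace.maximalIdeal_mk, hw, FinitePlace.mk_maximalIdeal]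

/-- Every archimedean place of `M` lies below some archimedean place of `L`. [cite: MochizukiFrdI2008, Ex. 6.3 p.113] -/
theorem comap_infinitePlace_surjective (σ : M →+* L) :
    Function.Surjective fun w : InfinitePlace L => w.comap σ := by
  letI : Algebra M L := σ.toAlgebra
  haveI : IsScalarTower ℚ M L := IsScalarTower.of_algebraMap_eq fun q => by
    show (algebraMap ℚ L) q = σ (algebraMap ℚ M q)
    simp
  haveI : Algebra.IsAlgebraic M L := Algebra.IsAlgebraic.tower_top (K := ℚ) M
  exact InfinitePlace.comap_surjective

/-- **Pull-back of effective arithmetic divisors is injective.** [cite: MochizukiFrdI2008, Ex. 6.3 p.113] -/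
theorem pullback_injective (σ : M →+* L) : Function.Injective (EffArithDivisor.pullback σ) := by
  intro D E h
  refine Prod.ext (Finsupp.ext fun v => ?_) (funext fun v => ?_)
  · obtain ⟨w, rfl⟩ := underPlace_surjective σ v
    have hw := congrArg (fun X : EffArithDivisor L => X.1 w) h
    simp only [EffArithDivisor.pullback_fst] at hw
    exact Nat.eq_of_mul_eq_mul_left (Nat.pos_of_ne_zero (ramIdx_ne_zero σ w.maximalIdeal)) hw
  · obtain ⟨w, rfl⟩ := comap_infinitePlace_surjective σ v
    have hw := congrArg (fun X : EffArithDivisor L => X.2 w) h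
    simpa using hw

/-- For an automorphism `ρ` of a number field `E` and a prime `v` with `ρ(v) ≠ v`, the place `v` does not lie
below itself along `ρ`. [cite: MochizukiFrdI2008, Thm. 6.4 (i) p.115] -/
theorem underPlace_ne_self_of_map_ne {E : Type u} [Field E] [NumberField E] (ρ : E ≃+* E)
    (v : HeightOneSpectrum (𝓞 E))
    (hv : Ideal.map (RingOfIntegers.mapRingEquiv ρ) v.asIdeal ≠ v.asIdeal) :
    underPlace (ρ : E →+* E) (FinitePlace.mk v) ≠ FinitePlace.mk v := by
  intro h
  rw [underPlace, FinitePlace.maximalIdeal_mk, FinitePlace.mk_eq_iff] at h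
  have h' := congrArg HeightOneSpectrum.asIdeal h
  rw [under_asIdeal] at h'
  apply hv
  have hsurj : Function.Surjective (RingOfIntegers.mapRingEquiv ρ) := (RingOfIntegers.mapRingEquiv ρ).surjective
  calc Ideal.map (RingOfIntegers.mapRingEquiv ρ) v.asIdeal
      = Ideal.map (RingOfIntegers.mapRingEquiv ρ)
          (Ideal.comap (RingOfIntegers.mapRingHom (ρ : E →+* E)) v.asIdeal) := by rw [h']
    _ = v.asIdeal := Ideal.map_comap_of_surjective _ hsurj _

end ArithPullback

open ArithPullback

/-! ### Div-slimness of `D` with respect to the arithmetic divisor monoid -/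

section DivSlim

variable (F : Type) [Field F] [NumberField F] (K : Type) [Field K] [Algebra F K]

/-- The pull-back operation of `C_{K/F}` is the pull-back of effective arithmetic divisors (unfolding).
[cite: MochizukiFrdI2008, Ex. 6.3 p.113] -/
theorem arithFrobenioidOps_pull {X Y : FinSubextCat F K} (m : Y ⟶ X) (x : (arithFrobenioidOps F K).Mon X) :
    (arithFrobenioidOps F K).pull m x =
      Multiplicative.ofAdd (EffArithDivisor.pullback m.toAlgHom.toRingHom (Multiplicative.toAdd x)) := rfl

/-- **Pull-back of divisors along the arrows of `D` is injective** for the arithmetic divisor monoid (the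
hypothesis `PullInjective` of the Div-slim criterion, here PROVED). [cite: MochizukiFrdI2008, Thm. 6.4 (i) p.115] -/
theorem pullInjective_arith : FinSubextCat.PullInjective (arithFrobenioidOps F K) := by
  intro X Y m x y h
  have h' : EffArithDivisor.pullback m.toAlgHom.toRingHom (Multiplicative.toAdd x) =
      EffArithDivisor.pullback m.toAlgHom.toRingHom (Multiplicative.toAdd y) :=
    congrArg Multiplicative.toAdd h
  exact Multiplicative.toAdd.injective (pullback_injective _ h')

variable [IsGalois F K]

/-- **Every `1 ≠ z ∈ Z` acts nontrivially on some `Φ(L)`, `L ⊆ K` finite Galois over `F`** (the hypothesis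
`MovesSomeGalois` of the Div-slim criterion, here PROVED for the arithmetic divisor monoid): `z` restricts to
a nontrivial automorphism of the normal closure `L` of `F(x₀)` (`z x₀ ≠ x₀`), which moves some prime `v` of
`L` ("any automorphism of a number field that fixes all of the valuations is the identity", FrdI p. 115;
`NumberFields.exists_map_heightOneSpectrum_ne`), so `z^*` moves the prime divisor `v`.
[cite: MochizukiFrdI2008, Thm. 6.4 (i) p.115] -/
theorem movesSomeGalois_arith : FinSubextCat.MovesSomeGalois (arithFrobenioidOps F K) := by
  intro z _ hz
  -- an element moved by `z`, its normal closure `E`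
  obtain ⟨x₀, hx₀⟩ : ∃ x₀ : K, z x₀ ≠ x₀ := by
    by_contra h
    push Not at h
    exact hz (AlgEquiv.ext h)
  haveI : FiniteDimensional F F⟮x₀⟯ :=
    IntermediateField.adjoin.finiteDimensional (Algebra.IsSeparable.isSeparable F x₀).isIntegral
  let E : IntermediateField F K := normalClosure F F⟮x₀⟯ K
  haveI : FiniteDimensional F E := normalClosure.is_finiteDimensional F F⟮x₀⟯ K
  haveI : Normal F E := normalClosure.normal F F⟮x₀⟯ K
  haveI : IsGalois F E := IsGalois.mk
  haveI : NumberField E := NumberField.of_module_finite F E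
  have hx₀E : x₀ ∈ E := IntermediateField.le_normalClosure _ (IntermediateField.mem_adjoin_simple_self F x₀)
  -- the restriction of `z` to `E` as a ring automorphism `ρ`
  let σ : (⟨E⟩ : FinSubextCat F K) ⟶ ⟨E⟩ := FinSubextCat.autMor E z
  let ρ : E ≃+* E := RingEquiv.ofBijective σ.toAlgHom.toRingHom
    (Algebra.IsAlgebraic.algHom_bijective σ.toAlgHom)
  have hρ : ρ ≠ RingEquiv.refl E := by
    intro h
    have := congrArg (fun r : E ≃+* E => ((r ⟨x₀, hx₀E⟩ : E) : K)) h
    exact hx₀ this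
  -- a prime of `E` moved by `ρ`
  obtain ⟨v, hv⟩ := Literature.NumberTheory.NumberFields.exists_map_heightOneSpectrum_ne ρ hρ
  refine ⟨⟨E⟩, inferInstance, σ, fun a => rfl, Multiplicative.ofAdd (Finsupp.single (FinitePlace.mk v) 1, 0), ?_⟩
  intro h
  have h' : (EffArithDivisor.pullback σ.toAlgHom.toRingHom (Finsupp.single (FinitePlace.mk v) 1, 0)).1
      (FinitePlace.mk v) = (Finsupp.single (FinitePlace.mk v) 1 : FinitePlace E →₀ ℕ) (FinitePlace.mk v) :=
    congrArg (fun x => (Multiplicative.toAdd x).1 (FinitePlace.mk v)) h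
  have hne : underPlace σ.toAlgHom.toRingHom (FinitePlace.mk v) ≠ FinitePlace.mk v :=
    underPlace_ne_self_of_map_ne ρ v hv
  rw [EffArithDivisor.pullback_fst, Finsupp.single_eq_same] at h'
  dsimp only at h'
  rw [Finsupp.single_eq_of_ne hne, mul_zero] at h'
  exact zero_ne_one h'

/-- **Theorem 6.4 (i): "`D` is Div-slim [with respect to `Φ`]"** — PROVED for the constructed arithmetic model
Frobenioid `C_{K/F}`: an automorphism of the forgetful functor `D_A → D` all of whose components act trivially
on the effective arithmetic divisors is trivial (Def. 4.5 (iv), unfolded; the packaging as abc-iut-L1-t3's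
`PreFrobenioidData.IsDivSlim` / `Thm64i_base` is in the companion of `ArithmeticFrobenioids.lean`).
[cite: MochizukiFrdI2008, Thm. 6.4 (i) p.114] -/
theorem aut_eq_one_arith (A : FinSubextCat F K) (α : Aut (Over.forget A))
    (hα : ∀ (B : Over A) (x : (arithFrobenioidOps F K).Mon B.left),
      (arithFrobenioidOps F K).pull (α.hom.app B) x = x) : α = 1 :=
  FinSubextCat.aut_eq_one_of_movesGalois (pullInjective_arith F K) (movesSomeGalois_arith F K) A α hα

end DivSlim

end Literature.AlgebraicGeometry.Frobenioids

end
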